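import Mathlib
import Literature.Analysis.Approximation.MateNevaiBoundedVariation
import HarnessLib

/-!
# Three-term recurrence of the orthonormal polynomials of an even measure

Helper for the line `FilterInvariance` of the crux `EmbeddedDrudeMourre.GreenKuboContinuation`
(stub `stub_mnRecurrence`, consumed by the composition `mateNevai_unitBand`): if every polynomial
is `τ`-integrable, `τ` is invariant under `ω ↦ -ω`, and `p : ℕ → ℝ[X]` is an orthonormal
polynomial sequence of `τ` (`natDegree (p n) = n`, positive leading coefficients `k_n`,
`∫ p_m p_n dτ = δ_{mn}`), then with `A n = k_n / k_{n+1}`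

  `X p_0 = A_0 p_1`, `X p_{n+1} = A_{n+1} p_{n+2} + A_n p_n`

(Szegő, *Orthogonal polynomials*, Thm 3.2.1, in the case of an even measure, whose diagonal
Jacobi coefficients `b_n = ∫ ω p_n(ω)² dτ` vanish:
`Literature.Analysis.Approximation.integral_mul_sq_eq_zero_of_map_neg`).

Proof: `p_0, …, p_{N-1}` span the polynomials of degree `< N`
(`Polynomial.Sequence.span_degreeLT`), and the coefficients of `r = Σ lᵢ pᵢ` are the Fourier
coefficients `lᵢ = ∫ r pᵢ dτ`; hence a polynomial of degree `< N` orthogonal to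
`p_0, …, p_{N-1}` vanishes, and `p_N` is orthogonal to every polynomial of degree `< N`. The
difference `X p_{n+1} - A_{n+1} p_{n+2} - A_n p_n` has degree `< n + 2` (the leading coefficients
of `X p_{n+1}` and `A_{n+1} p_{n+2}` agree) and is orthogonal to `p_m` for `m < n + 2`: for
`m < n` because `deg (X p_m) = m + 1 < n + 1`, for `m = n` because `∫ X p_n p_{n+1} dτ = A_n`
(`X p_n = A_n p_{n+1} +` lower order), for `m = n + 1` because `b_{n+1} = 0`.
-/

noncomputable section

namespace Summit.AtomisticToContinuum.FouriersLaw.Theorems.GreenKuboContinuation.BandLimitedKrylov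

open Filter Topology MeasureTheory Set Polynomial

section OrthonormalPolySeq

variable {τ : Measure ℝ} {p : ℕ → ℝ[X]}

/-- Products of polynomial functions are `τ`-integrable when all polynomial functions are. -/
theorem mnRec_integrable_mul (hint : ∀ f : ℝ[X], Integrable (fun ω => f.eval ω) τ)
    (f g : ℝ[X]) : Integrable (fun ω => f.eval ω * g.eval ω) τ := by
  simpa only [eval_mul] using hint (f * g)

/-- `ω ↦ ω f(ω) g(ω)` is `τ`-integrable for polynomials `f`, `g` when all polynomial functions
are. -/
theorem mnRec_integrable_id_mul (hint : ∀ f : ℝ[X], Integrable (fun ω => f.eval ω) τ)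
    (f g : ℝ[X]) : Integrable (fun ω => ω * (f.eval ω * g.eval ω)) τ := by
  have h := hint (X * (f * g))
  simp only [eval_mul, eval_X] at h
  exact h

/-- A polynomial sequence with `natDegree (p n) = n` and non-vanishing leading coefficients has
`degree (p n) = n`. -/
theorem mnRec_degree_eq (hpdeg : ∀ n, (p n).natDegree = n)
    (hplc : ∀ n, 0 < (p n).leadingCoeff) (n : ℕ) : (p n).degree = n := by
  rw [degree_eq_natDegree (leadingCoeff_ne_zero.1 (hplc n).ne'), hpdeg n]

/-- **Fourier coefficients.** For an orthonormal sequence `p` and a finitely supported family of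
coefficients `l`, `∫ (Σᵢ lᵢ pᵢ) p_m dτ = l_m`. -/
theorem mnRec_integral_linearCombination_mul
    (hint : ∀ f : ℝ[X], Integrable (fun ω => f.eval ω) τ)
    (hporth : ∀ m n, ∫ ω, (p m).eval ω * (p n).eval ω ∂τ = if m = n then 1 else 0)
    (l : ℕ →₀ ℝ) (m : ℕ) :
    ∫ ω, (Finsupp.linearCombination ℝ p l).eval ω * (p m).eval ω ∂τ = l m := by
  have e : ∀ ω, (Finsupp.linearCombination ℝ p l).eval ω * (p m).eval ω =
      ∑ i ∈ l.support, l i * ((p i).eval ω * (p m).eval ω) := fun ω => by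
    rw [Finsupp.linearCombination_apply, Finsupp.sum, eval_finsetSum, Finset.sum_mul]
    exact Finset.sum_congr rfl fun i _ => by rw [eval_smul, smul_eq_mul, mul_assoc]
  simp_rw [e]
  rw [integral_finsetSum _ (fun i _ => (mnRec_integrable_mul hint (p i) (p m)).const_mul (l i))]
  simp_rw [integral_const_mul, hporth, mul_ite, mul_one, mul_zero, Finset.sum_ite_eq']
  by_cases hms : m ∈ l.support
  · rw [if_pos hms]
  · rw [if_neg hms]; exact (Finsupp.notMem_support_iff.1 hms).symm

/-- A polynomial of degree `< N` is a finitely supported linear combination of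
`p 0, …, p (N - 1)` (`Polynomial.Sequence.span_degreeLT`). -/
theorem mnRec_exists_linearCombination (hpdeg : ∀ n, (p n).natDegree = n)
    (hplc : ∀ n, 0 < (p n).leadingCoeff) (N : ℕ) (r : ℝ[X]) (hr : r.degree < N) :
    ∃ l ∈ Finsupp.supported ℝ ℝ (Set.Iio N), Finsupp.linearCombination ℝ p l = r := by
  have hspan : Submodule.span ℝ (p '' Set.Iio N) = degreeLT ℝ N :=
    (⟨p, mnRec_degree_eq hpdeg hplc⟩ : Polynomial.Sequence ℝ).span_degreeLT
      fun i _ => (hplc i).ne'.isUnit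
  exact (Finsupp.mem_span_image_iff_linearCombination ℝ).1
    (show r ∈ Submodule.span ℝ (p '' Set.Iio N) by rw [hspan]; exact mem_degreeLT.2 hr)

/-- A polynomial of degree `< N` that is orthogonal to `p 0, …, p (N - 1)` vanishes. -/
theorem mnRec_eq_zero_of_orthogonal (hint : ∀ f : ℝ[X], Integrable (fun ω => f.eval ω) τ)
    (hpdeg : ∀ n, (p n).natDegree = n) (hplc : ∀ n, 0 < (p n).leadingCoeff)
    (hporth : ∀ m n, ∫ ω, (p m).eval ω * (p n).eval ω ∂τ = if m = n then 1 else 0)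
    (N : ℕ) (r : ℝ[X]) (hr : r.degree < N)
    (horth : ∀ m < N, ∫ ω, r.eval ω * (p m).eval ω ∂τ = 0) : r = 0 := by
  obtain ⟨l, hl, hlr⟩ := mnRec_exists_linearCombination hpdeg hplc N r hr
  suffices hcoef : ∀ m, l m = 0 by rw [← hlr, (Finsupp.ext hcoef : l = 0), map_zero]
  intro m
  by_cases hm : m < N
  · rw [← mnRec_integral_linearCombination_mul hint hporth l m, hlr]; exact horth m hm
  · exact Finsupp.notMem_support_iff.1 fun h => hm ((Finsupp.mem_supported _ _).1 hl h)

/-- `p N` is orthogonal to every polynomial of degree `< N`. -/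
theorem mnRec_integral_mul_eq_zero_of_degree_lt
    (hint : ∀ f : ℝ[X], Integrable (fun ω => f.eval ω) τ)
    (hpdeg : ∀ n, (p n).natDegree = n) (hplc : ∀ n, 0 < (p n).leadingCoeff)
    (hporth : ∀ m n, ∫ ω, (p m).eval ω * (p n).eval ω ∂τ = if m = n then 1 else 0)
    (N : ℕ) (r : ℝ[X]) (hr : r.degree < N) :
    ∫ ω, r.eval ω * (p N).eval ω ∂τ = 0 := by
  obtain ⟨l, hl, hlr⟩ := mnRec_exists_linearCombination hpdeg hplc N r hr
  rw [← hlr, mnRec_integral_linearCombination_mul hint hporth l N]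
  exact Finsupp.notMem_support_iff.1 fun h => lt_irrefl N ((Finsupp.mem_supported _ _).1 hl h)

/-- The polynomial `X p_n - A_n p_{n+1}`, `A_n = k_n / k_{n+1}`, has degree `< n + 1`: both
terms have degree `n + 1` and leading coefficient `k_n`. -/
theorem mnRec_degree_X_mul_sub_lt (hpdeg : ∀ n, (p n).natDegree = n)
    (hplc : ∀ n, 0 < (p n).leadingCoeff) (A : ℕ → ℝ)
    (hA : ∀ n, A n = (p n).leadingCoeff / (p (n + 1)).leadingCoeff) (n : ℕ) :
    (X * p n - C (A n) * p (n + 1)).degree < ((n + 1 : ℕ) : WithBot ℕ) := by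
  have hk1 : (p (n + 1)).leadingCoeff ≠ 0 := (hplc _).ne'
  have hA0 : A n ≠ 0 := by rw [hA]; exact div_ne_zero (hplc n).ne' hk1
  have h1 : (X * p n).degree = ((n + 1 : ℕ) : WithBot ℕ) := by
    rw [mul_comm, degree_mul_X, mnRec_degree_eq hpdeg hplc, Nat.cast_succ]
  have h2 : (C (A n) * p (n + 1)).degree = ((n + 1 : ℕ) : WithBot ℕ) := by
    rw [degree_C_mul hA0, mnRec_degree_eq hpdeg hplc]
  have hne : X * p n ≠ 0 := fun h => by
    rw [h, degree_zero] at h1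
    exact WithBot.bot_ne_coe h1
  have hlc : (X * p n).leadingCoeff = (C (A n) * p (n + 1)).leadingCoeff := by
    rw [mul_comm, leadingCoeff_mul_X, leadingCoeff_mul, leadingCoeff_C, hA,
      div_mul_cancel₀ _ hk1]
  exact (degree_sub_lt (h1.trans h2.symm) hne hlc).trans_eq h1

/-- `∫ ω p_N(ω) p_m(ω) dτ = 0` for `m + 1 < N`, since `deg (X p_m) = m + 1 < N`. -/
theorem mnRec_integral_id_mul_eq_zero (hint : ∀ f : ℝ[X], Integrable (fun ω => f.eval ω) τ)
    (hpdeg : ∀ n, (p n).natDegree = n) (hplc : ∀ n, 0 < (p n).leadingCoeff)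
    (hporth : ∀ m n, ∫ ω, (p m).eval ω * (p n).eval ω ∂τ = if m = n then 1 else 0)
    (N m : ℕ) (hm : m + 1 < N) :
    ∫ ω, ω * ((p N).eval ω * (p m).eval ω) ∂τ = 0 := by
  have hdeg : (X * p m).degree < (N : WithBot ℕ) := by
    rw [mul_comm, degree_mul_X, mnRec_degree_eq hpdeg hplc]
    exact_mod_cast hm
  calc ∫ ω, ω * ((p N).eval ω * (p m).eval ω) ∂τ
      = ∫ ω, (X * p m).eval ω * (p N).eval ω ∂τ :=
        integral_congr_ae (Eventually.of_forall fun ω => by simp only [eval_mul, eval_X]; ring)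
    _ = 0 := mnRec_integral_mul_eq_zero_of_degree_lt hint hpdeg hplc hporth N (X * p m) hdeg

/-- `∫ ω p_{n+1}(ω) p_n(ω) dτ = A_n = k_n / k_{n+1}`: indeed `X p_n = A_n p_{n+1} + r` with
`deg r < n + 1`, and `p_{n+1} ⊥ r`. -/
theorem mnRec_integral_id_mul_succ (hint : ∀ f : ℝ[X], Integrable (fun ω => f.eval ω) τ)
    (hpdeg : ∀ n, (p n).natDegree = n) (hplc : ∀ n, 0 < (p n).leadingCoeff)
    (hporth : ∀ m n, ∫ ω, (p m).eval ω * (p n).eval ω ∂τ = if m = n then 1 else 0)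
    (A : ℕ → ℝ) (hA : ∀ n, A n = (p n).leadingCoeff / (p (n + 1)).leadingCoeff) (n : ℕ) :
    ∫ ω, ω * ((p (n + 1)).eval ω * (p n).eval ω) ∂τ = A n := by
  set r : ℝ[X] := X * p n - C (A n) * p (n + 1) with hr
  have hrdeg : r.degree < ((n + 1 : ℕ) : WithBot ℕ) := mnRec_degree_X_mul_sub_lt hpdeg hplc A hA n
  calc ∫ ω, ω * ((p (n + 1)).eval ω * (p n).eval ω) ∂τ
      = ∫ ω, (r.eval ω * (p (n + 1)).eval ω +
          A n * ((p (n + 1)).eval ω * (p (n + 1)).eval ω)) ∂τ :=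
        integral_congr_ae (Eventually.of_forall fun ω => by
          simp only [hr, eval_sub, eval_mul, eval_X, eval_C]; ring)
    _ = ∫ ω, r.eval ω * (p (n + 1)).eval ω ∂τ +
          A n * ∫ ω, (p (n + 1)).eval ω * (p (n + 1)).eval ω ∂τ := by
        rw [integral_add (mnRec_integrable_mul hint _ _)
          ((mnRec_integrable_mul hint _ _).const_mul _), integral_const_mul]
    _ = A n := by
        rw [mnRec_integral_mul_eq_zero_of_degree_lt hint hpdeg hplc hporth (n + 1) r hrdeg,
          hporth, if_pos rfl, zero_add, mul_one]

/-- `b_n = ∫ ω p_n(ω)² dτ = 0` for an even measure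
(`Literature.Analysis.Approximation.integral_mul_sq_eq_zero_of_map_neg`). -/
theorem mnRec_integral_id_mul_self (heven : τ.map (fun ω : ℝ => -ω) = τ)
    (hint : ∀ f : ℝ[X], Integrable (fun ω => f.eval ω) τ)
    (hpdeg : ∀ n, (p n).natDegree = n) (hplc : ∀ n, 0 < (p n).leadingCoeff)
    (hporth : ∀ m n, ∫ ω, (p m).eval ω * (p n).eval ω ∂τ = if m = n then 1 else 0) (n : ℕ) :
    ∫ ω, ω * ((p n).eval ω * (p n).eval ω) ∂τ = 0 := by
  have h := Literature.Analysis.Approximation.integral_mul_sq_eq_zero_of_map_neg τ heven hint p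
    hpdeg hplc hporth n
  simpa only [sq] using h

end OrthonormalPolySeq

/-- **`stub_mnRecurrence` — three-term recurrence of the orthonormal polynomials of an even
measure.** If every polynomial is `τ`-integrable, `τ` is even, and `p_n` is an orthonormal
polynomial sequence of `τ` (`deg p_n = n`, `k_n > 0`), then with `A n = k_n / k_{n+1}`:
`x p_0 = A_0 p_1` and `x p_{n+1} = A_{n+1} p_{n+2} + A_n p_n` (the diagonal coefficients
`b_n = ∫ x p_n² dτ` vanish by
`Literature.Analysis.Approximation.integral_mul_sq_eq_zero_of_map_neg`; the difference of the two
sides has degree `< n + 2` and is orthogonal to `p_0, …, p_{n+1}`, hence vanishes)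
(Szegő, *Orthogonal polynomials*, Thm 3.2.1; Chihara Ch. I §4). -/
theorem stub_mnRecurrence :
    ∀ (τ : Measure ℝ) (p : ℕ → ℝ[X]) (A : ℕ → ℝ),
      (∀ f : ℝ[X], Integrable (fun ω => f.eval ω) τ) →
      τ.map (fun ω : ℝ => -ω) = τ →
      (∀ n, (p n).natDegree = n) → (∀ n, 0 < (p n).leadingCoeff) →
      (∀ m n, ∫ ω, (p m).eval ω * (p n).eval ω ∂τ = if m = n then 1 else 0) →
      (∀ n, A n = (p n).leadingCoeff / (p (n + 1)).leadingCoeff) →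
      X * p 0 = C (A 0) * p 1 ∧
        ∀ n, X * p (n + 1) = C (A (n + 1)) * p (n + 2) + C (A n) * p n := by
  intro τ p A hint heven hpdeg hplc hporth hA
  have hint2 := mnRec_integrable_mul (τ := τ) hint
  have hint3 := mnRec_integrable_id_mul (τ := τ) hint
  have hb := mnRec_integral_id_mul_self heven hint hpdeg hplc hporth
  refine ⟨?_, fun n => ?_⟩
  · -- `X p_0 - A_0 p_1` has degree `< 1` and is orthogonal to `p_0`
    have hr : (X * p 0 - C (A 0) * p 1).degree < ((1 : ℕ) : WithBot ℕ) :=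
      mnRec_degree_X_mul_sub_lt hpdeg hplc A hA 0
    refine sub_eq_zero.1 (mnRec_eq_zero_of_orthogonal hint hpdeg hplc hporth 1
      (X * p 0 - C (A 0) * p 1) hr fun m hm => ?_)
    obtain rfl : m = 0 := by omega
    have e : ∀ ω, (X * p 0 - C (A 0) * p 1).eval ω * (p 0).eval ω =
        ω * ((p 0).eval ω * (p 0).eval ω) - A 0 * ((p 1).eval ω * (p 0).eval ω) := fun ω => by
      simp only [eval_sub, eval_mul, eval_X, eval_C]; ring
    simp_rw [e]
    rw [integral_sub (hint3 _ _) ((hint2 _ _).const_mul _), integral_const_mul, hb 0, hporth,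
      if_neg Nat.one_ne_zero]
    ring
  · -- `X p_{n+1} - A_{n+1} p_{n+2} - A_n p_n` has degree `< n + 2` and is orthogonal to `p_m`,
    -- `m < n + 2`
    have hAn0 : A n ≠ 0 := by rw [hA]; exact div_ne_zero (hplc n).ne' (hplc _).ne'
    have hdeg : (X * p (n + 1) - C (A (n + 1)) * p (n + 2) - C (A n) * p n).degree <
        ((n + 2 : ℕ) : WithBot ℕ) := by
      refine (degree_sub_le _ _).trans_lt (max_lt ?_ ?_)
      · exact mnRec_degree_X_mul_sub_lt hpdeg hplc A hA (n + 1)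
      · rw [degree_C_mul hAn0, mnRec_degree_eq hpdeg hplc]
        exact_mod_cast (by omega : n < n + 2)
    have hq := mnRec_eq_zero_of_orthogonal hint hpdeg hplc hporth (n + 2)
      (X * p (n + 1) - C (A (n + 1)) * p (n + 2) - C (A n) * p n) hdeg fun m hm => by
      have e : ∀ ω, (X * p (n + 1) - C (A (n + 1)) * p (n + 2) - C (A n) * p n).eval ω *
          (p m).eval ω = ω * ((p (n + 1)).eval ω * (p m).eval ω) -
            A (n + 1) * ((p (n + 2)).eval ω * (p m).eval ω) -
            A n * ((p n).eval ω * (p m).eval ω) := fun ω => by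
        simp only [eval_sub, eval_mul, eval_X, eval_C]; ring
      have h1 : Integrable (fun ω => ω * ((p (n + 1)).eval ω * (p m).eval ω) -
          A (n + 1) * ((p (n + 2)).eval ω * (p m).eval ω)) τ :=
        (hint3 _ _).sub ((hint2 _ _).const_mul _)
      simp_rw [e]
      rw [integral_sub h1 ((hint2 _ _).const_mul _),
        integral_sub (hint3 _ _) ((hint2 _ _).const_mul _), integral_const_mul,
        integral_const_mul, hporth, hporth, if_neg (show n + 2 ≠ m by omega)]
      rcases (by omega : m < n ∨ m = n ∨ m = n + 1) with hm' | rfl | rfl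
      · rw [mnRec_integral_id_mul_eq_zero hint hpdeg hplc hporth (n + 1) m (by omega),
          if_neg (show n ≠ m by omega)]
        ring
      · rw [mnRec_integral_id_mul_succ hint hpdeg hplc hporth A hA, if_pos rfl]
        ring
      · rw [hb, if_neg (show n ≠ n + 1 by omega)]
        ring
    rw [sub_sub] at hq
    exact sub_eq_zero.1 hq

end Summit.AtomisticToContinuum.FouriersLaw.Theorems.GreenKuboContinuation.BandLimitedKrylov

end
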